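import Summits.AtomisticToContinuum.HydrodynamicLimit.Theorems.AntiMazurCoboundariesCellForecastPressureDecayObjects
import Literature.Probability.LatticeModels.ClusterExpansionKPBound
import Literature.Probability.LatticeModels.PolymerPressureAnalytic
import Literature.Probability.LatticeModels.PolymerGasRatio
import HarnessLib

/-!
# Stub `stub_dobrushinHolomorphicLog` of the crux line `tilt-analyticity-transfer`
(crux `AntiMazurCoboundaries.CellForecastPressureDecay`, stmt-AtomisticToContinuum-13915)

Helper file of the line (`--supports stmt-AtomisticToContinuum-13915`); objects imported from
`Theorems/AntiMazurCoboundariesCellForecastPressureDecayObjects.lean` (namespace `…Theorems.TiltAnalyticity`, p80905).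

The stub is the abstract Kotecký–Preiss / Dobrushin step for the hard-core SUBSET POLYMER GAS on the
labels `Fin n` (polymers = nonempty label sets, incompatible iff they `Overlap`, activities `κ c B`
holomorphic in the tilt `c` and vanishing at `c = 0`): under the SITE criterion
`Σ_{B ∋ i} ‖κ c B‖ e^{a|B|} ≤ a` (all `‖c‖ < ρ`, all sites `i`) the gas is zero-free on the tilt disc
and `q c := log Z(κ c)` — the tree's Kotecký–Preiss branch `polymerLogZ` — is holomorphic, vanishes at
`c = 0`, exponentiates to `subsetGasZ (κ c) univ`, and has volume order `‖q c‖ ≤ a n`.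

Proof (all inputs are tree lemmas of `Literature/Probability/LatticeModels/ClusterExpansion*.lean`,
`PolymerPressure(Analytic).lean`, `PolymerGasRatio.lean`):
* the site criterion gives the finite-volume KP condition `IsKPVolume Overlap (κ c) (a|·|) Λ` on every
  family `Λ` of label sets (`sum_filter_overlap_le_of_site`: a set overlapping `γ` is `∅`, of zero
  activity, or contains a point of `γ`);
* zero-freeness along the rays `u • κ c` (`IsKPVolume.ray`, `polymerPartitionFunction_ne_zero_of_kp`)
  feeds `differentiableOn_polymerLogZ_param` (holomorphy) and `exp_polymerLogZ_of_kp` (logarithm);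
* `q 0 = 0`: at zero activity every truncated functional vanishes (`truncatedWeight_empty`,
  `truncatedWeight_eq_zero_of_mem_of_eq_zero`) in the expansion (2) `polymerLogZ_eq_sum_truncatedWeight`;
* `‖q c‖ ≤ a n`: in (2) every nonempty family `C` touches a one-point polymer `{i}`, and the
  Kotecký–Preiss estimate (4) (`koteckyPreiss_truncatedWeight_bound_holds`,
  `sum_norm_truncatedWeight_le_of_touches`) bounds the families touching `{i}` by `a |{i}| = a`.
-/

noncomputable section

open MeasureTheory Set Metric Filter ProbabilityTheory Topology
open scoped ENNReal BigOperators
open Literature.Analysis.FluidPDE Literature.MathematicalPhysics.KineticTheory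
open Literature.Probability.LatticeModels (polymerPartitionFunction)

namespace Summit.AtomisticToContinuum.HydrodynamicLimit.Theorems.TiltAnalyticity

/-! ## The stub `stub_dobrushinHolomorphicLog` (S2c): Kotecký–Preiss logarithm of the subset gas -/

section DobrushinHolomorphicLog

open Literature.Probability.LatticeModels (IsKPVolume kpTerm KPTouches polymerLogZ truncatedWeight
  polymerPartitionFunction_ne_zero_of_kp exp_polymerLogZ_of_kp polymerLogZ_eq_sum_truncatedWeight
  truncatedWeight_empty truncatedWeight_eq_zero_of_mem_of_eq_zero sum_biUnion_le_sum_of_nonneg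
  koteckyPreiss_truncatedWeight_bound_holds sum_norm_truncatedWeight_le_of_touches
  kp_hypothesis_of_fintype differentiableOn_polymerLogZ_param IsKPVolume.ray)

/-- **The site criterion implies the Kotecký–Preiss condition** for the subset polymer gas with size
function `a |B|`: for every label set `γ` and every family `Λ` of label sets,
`Σ_{γ' ∈ Λ, γ' overlaps γ} ‖w γ'‖ e^{a|γ'|} ≤ a |γ|` (the overlapping sets are `∅` — of zero
activity — or contain a point of `γ`; sum the site criterion over the points of `γ`). [folklore] -/
theorem sum_filter_overlap_le_of_site {n : ℕ} (w : Finset (Fin n) → ℂ) (a : ℝ) (hempty : w ∅ = 0)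
    (hsite : ∀ i : Fin n,
      ∑ B ∈ (Finset.univ : Finset (Finset (Fin n))).filter (fun B => i ∈ B),
        ‖w B‖ * Real.exp (a * B.card) ≤ a)
    (Λ : Finset (Finset (Fin n))) (γ : Finset (Fin n)) :
    ∑ γ' ∈ Λ with Overlap γ' γ, ‖w γ'‖ * Real.exp (a * γ'.card) ≤ a * γ.card := by
  have hnn : ∀ B : Finset (Fin n), 0 ≤ ‖w B‖ * Real.exp (a * B.card) := fun B =>
    mul_nonneg (norm_nonneg _) (Real.exp_nonneg _)
  set S : Finset (Finset (Fin n)) :=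
    γ.biUnion fun x => (Finset.univ : Finset (Finset (Fin n))).filter fun B => x ∈ B with hS
  have hsub : Λ.filter (fun γ' => Overlap γ' γ) ⊆ insert ∅ S := by
    intro γ' hγ'
    obtain ⟨-, hov⟩ := Finset.mem_filter.1 hγ'
    rw [Finset.mem_insert, hS, Finset.mem_biUnion]
    rcases hov with hnd | rfl
    · obtain ⟨x, hx', hx⟩ := Finset.not_disjoint_iff.1 hnd
      exact Or.inr ⟨x, hx, Finset.mem_filter.2 ⟨Finset.mem_univ _, hx'⟩⟩
    · rcases γ'.eq_empty_or_nonempty with h | ⟨x, hx⟩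
      · exact Or.inl h
      · exact Or.inr ⟨x, hx, Finset.mem_filter.2 ⟨Finset.mem_univ _, hx⟩⟩
  have hSempty : (∅ : Finset (Fin n)) ∉ S := by
    rw [hS, Finset.mem_biUnion]
    rintro ⟨x, -, hx⟩
    exact Finset.notMem_empty x (Finset.mem_filter.1 hx).2
  calc ∑ γ' ∈ Λ with Overlap γ' γ, ‖w γ'‖ * Real.exp (a * γ'.card)
      ≤ ∑ γ' ∈ insert ∅ S, ‖w γ'‖ * Real.exp (a * γ'.card) :=
        Finset.sum_le_sum_of_subset_of_nonneg hsub fun B _ _ => hnn B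
    _ = ∑ γ' ∈ S, ‖w γ'‖ * Real.exp (a * γ'.card) := by
        rw [Finset.sum_insert hSempty, hempty, norm_zero, zero_mul, zero_add]
    _ ≤ ∑ x ∈ γ, ∑ γ' ∈ (Finset.univ : Finset (Finset (Fin n))).filter (fun B => x ∈ B),
          ‖w γ'‖ * Real.exp (a * γ'.card) := sum_biUnion_le_sum_of_nonneg _ _ _ hnn
    _ ≤ ∑ _x ∈ γ, a := Finset.sum_le_sum fun x _ => hsite x
    _ = a * γ.card := by rw [Finset.sum_const, nsmul_eq_mul, mul_comm]

/-- The site criterion gives the finite-volume KP condition `IsKPVolume` of the subset gas on every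
family of label sets, with size function `B ↦ a |B|`. [folklore] -/
theorem isKPVolume_of_site {n : ℕ} (w : Finset (Fin n) → ℂ) (a : ℝ) (hempty : w ∅ = 0)
    (hsite : ∀ i : Fin n,
      ∑ B ∈ (Finset.univ : Finset (Finset (Fin n))).filter (fun B => i ∈ B),
        ‖w B‖ * Real.exp (a * B.card) ≤ a)
    (Λ : Finset (Finset (Fin n))) :
    IsKPVolume Overlap w (fun B : Finset (Fin n) => a * B.card) Λ := by
  intro γ _
  simp only [kpTerm]
  exact sum_filter_overlap_le_of_site w a hempty hsite Λ γ

/-- **Volume-order bound on the Kotecký–Preiss logarithm of the subset gas** under the site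
criterion: `‖log Z‖ ≤ a n` (expansion (2) `log Z = Σ_C Φ^T(C)`; every nonempty family `C` touches a
one-point polymer `{i}`, and the Kotecký–Preiss estimate (4) bounds the families touching `{i}` by
`a |{i}| = a`). [cite: KoteckyPreiss1986, Theorem p. 492, estimate (4)] -/
theorem norm_polymerLogZ_le_of_site {n : ℕ} (w : Finset (Fin n) → ℂ) {a : ℝ} (ha : 0 ≤ a)
    (hempty : w ∅ = 0)
    (hsite : ∀ i : Fin n,
      ∑ B ∈ (Finset.univ : Finset (Finset (Fin n))).filter (fun B => i ∈ B),
        ‖w B‖ * Real.exp (a * B.card) ≤ a)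
    (Λ : Finset (Finset (Fin n))) (hΛ : ∅ ∉ Λ) :
    ‖polymerLogZ Overlap w Λ‖ ≤ a * n := by
  haveI : Std.Refl (Overlap (ι := Fin n)) := ⟨overlap_refl⟩
  haveI : Std.Symm (Overlap (ι := Fin n)) := ⟨overlap_symm⟩
  -- the Kotecký–Preiss estimate (4) at the one-point polymers
  have hglob : ∀ γ : Finset (Fin n),
      ∑ γ' ∈ (Finset.univ : Finset (Finset (Fin n))) with Overlap γ' γ,
        ‖w γ'‖ * Real.exp ((fun B : Finset (Fin n) => a * B.card) γ' +
          (fun _ : Finset (Fin n) => (0 : ℝ)) γ') ≤ (fun B : Finset (Fin n) => a * B.card) γ := by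
    intro γ
    simpa only [add_zero] using sum_filter_overlap_le_of_site w a hempty hsite Finset.univ γ
  have h1 := kp_hypothesis_of_fintype (inc := Overlap) hglob
  have hfact := koteckyPreiss_truncatedWeight_bound_holds (Overlap (ι := Fin n)) w
    (fun B : Finset (Fin n) => a * B.card) (fun _ => (0 : ℝ))
  have ha' : ∀ B : Finset (Fin n), 0 ≤ (fun B : Finset (Fin n) => a * B.card) B := fun B =>
    mul_nonneg ha (Nat.cast_nonneg _)
  have hd' : ∀ B : Finset (Fin n), 0 ≤ (fun _ : Finset (Fin n) => (0 : ℝ)) B := fun _ => le_rfl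
  have htouch : ∀ i : Fin n,
      ∑ C ∈ Λ.powerset with KPTouches Overlap C ({i} : Finset (Fin n)),
        ‖truncatedWeight Overlap w C‖ ≤ a := by
    intro i
    have h := sum_norm_truncatedWeight_le_of_touches hfact ha' hd' h1 Λ.powerset ({i} : Finset (Fin n))
    simpa only [Finset.card_singleton, Nat.cast_one, mul_one] using h
  -- every nonempty family of nonempty label sets touches a one-point polymer
  have hsub : Λ.powerset.erase ∅ ⊆ (Finset.univ : Finset (Fin n)).biUnion fun i =>
      Λ.powerset.filter fun C => KPTouches Overlap C ({i} : Finset (Fin n)) := by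
    intro C hC
    obtain ⟨hCne, hCΛ⟩ := Finset.mem_erase.1 hC
    obtain ⟨B, hB⟩ := Finset.nonempty_iff_ne_empty.2 hCne
    have hBne : B ≠ ∅ := fun h => hΛ (h ▸ Finset.mem_powerset.1 hCΛ hB)
    obtain ⟨i, hi⟩ := Finset.nonempty_iff_ne_empty.2 hBne
    refine Finset.mem_biUnion.2 ⟨i, Finset.mem_univ _, Finset.mem_filter.2 ⟨hCΛ, B, hB, ?_⟩⟩
    exact Or.inl fun h => Finset.disjoint_singleton_right.1 h hi
  rw [polymerLogZ_eq_sum_truncatedWeight, ← Finset.sum_erase Λ.powerset (truncatedWeight_empty w)]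
  calc ‖∑ C ∈ Λ.powerset.erase ∅, truncatedWeight Overlap w C‖
      ≤ ∑ C ∈ Λ.powerset.erase ∅, ‖truncatedWeight Overlap w C‖ := norm_sum_le _ _
    _ ≤ ∑ C ∈ (Finset.univ : Finset (Fin n)).biUnion (fun i =>
          Λ.powerset.filter fun C => KPTouches Overlap C ({i} : Finset (Fin n))),
          ‖truncatedWeight Overlap w C‖ :=
        Finset.sum_le_sum_of_subset_of_nonneg hsub fun _ _ _ => norm_nonneg _
    _ ≤ ∑ i : Fin n, ∑ C ∈ Λ.powerset with KPTouches Overlap C ({i} : Finset (Fin n)),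
          ‖truncatedWeight Overlap w C‖ :=
        sum_biUnion_le_sum_of_nonneg _ _ _ fun _ => norm_nonneg _
    _ ≤ ∑ _i : Fin n, a := Finset.sum_le_sum fun i _ => htouch i
    _ = a * n := by rw [Finset.sum_const, Finset.card_univ, Fintype.card_fin, nsmul_eq_mul, mul_comm]

/-- At zero activity the Kotecký–Preiss logarithm vanishes (every truncated functional has a member
of zero activity, or is `Φ^T(∅) = 0`). [folklore] -/
theorem polymerLogZ_eq_zero_of_forall {n : ℕ} (w : Finset (Fin n) → ℂ) (hw : ∀ B, w B = 0)
    (Λ : Finset (Finset (Fin n))) : polymerLogZ Overlap w Λ = 0 := by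
  haveI : Std.Symm (Overlap (ι := Fin n)) := ⟨overlap_symm⟩
  rw [polymerLogZ_eq_sum_truncatedWeight]
  refine Finset.sum_eq_zero fun C _ => ?_
  rcases C.eq_empty_or_nonempty with rfl | ⟨δ, hδ⟩
  · exact truncatedWeight_empty w
  · exact truncatedWeight_eq_zero_of_mem_of_eq_zero hδ (hw δ)

/-- **Registered stub S2c `stub_dobrushinHolomorphicLog`** (line `tilt-analyticity-transfer`, crux
stmt-AtomisticToContinuum-13915): DOBRUSHIN ⇒ HOLOMORPHIC VOLUME-ORDER LOGARITHM of the subset polymer gas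
under the site criterion (Kotecký–Preiss 1986 / Dobrushin 1996 / Fernández–Procacci 2007 §2).
[cite: FernandezProcacci2007, §2] -/
theorem stub_dobrushinHolomorphicLog :
    ∀ (n : ℕ) (κ : ℂ → Finset (Fin n) → ℂ) (ρ a : ℝ), 0 < ρ → 0 < a →
      (∀ B : Finset (Fin n), DifferentiableOn ℂ (fun c => κ c B) (ball 0 ρ)) →
      (∀ B : Finset (Fin n), κ 0 B = 0) → (∀ c : ℂ, κ c ∅ = 0) →
      (∀ c : ℂ, ‖c‖ < ρ → ∀ i : Fin n,
        ∑ B ∈ (Finset.univ : Finset (Finset (Fin n))).filter (fun B => i ∈ B),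
          ‖κ c B‖ * Real.exp (a * B.card) ≤ a) →
      ∃ q : ℂ → ℂ, DifferentiableOn ℂ q (ball 0 ρ) ∧ q 0 = 0 ∧ ∀ c : ℂ, ‖c‖ < ρ →
        Complex.exp (q c) = subsetGasZ (κ c) Finset.univ ∧ ‖q c‖ ≤ a * n := by
  intro n κ ρ a _hρ ha hdiff h0 hempty hsite
  haveI : Std.Refl (Overlap (ι := Fin n)) := ⟨overlap_refl⟩
  haveI : Std.Symm (Overlap (ι := Fin n)) := ⟨overlap_symm⟩
  -- the polymers: nonempty label sets; `subsetGasZ (κ c) univ = Z(Λ; κ c)` by definition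
  set Λ : Finset (Finset (Fin n)) :=
    (Finset.univ : Finset (Fin n)).powerset.filter Finset.Nonempty
  have hΛne : (∅ : Finset (Fin n)) ∉ Λ := fun h =>
    Finset.not_nonempty_empty (Finset.mem_filter.1 h).2
  have hKP : ∀ c : ℂ, ‖c‖ < ρ → IsKPVolume Overlap (κ c) (fun B : Finset (Fin n) => a * B.card) Λ :=
    fun c hc => isKPVolume_of_site (κ c) a (hempty c) (hsite c hc) Λ
  refine ⟨fun c => polymerLogZ Overlap (κ c) Λ, ?_, ?_, fun c hc => ⟨?_, ?_⟩⟩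
  · -- holomorphy on the tilt disc: zero-freeness along the rays `u • κ c`, `u ∈ [0,1]`
    refine differentiableOn_polymerLogZ_param Λ Metric.isOpen_ball (fun B _ => hdiff B) ?_
    intro c hc u hu
    exact polymerPartitionFunction_ne_zero_of_kp ((hKP c (mem_ball_zero_iff.1 hc)).ray hu)
      subset_rfl
  · -- `q 0 = 0`
    exact polymerLogZ_eq_zero_of_forall (κ 0) h0 Λ
  · -- `exp (q c) = Z(c)`
    exact exp_polymerLogZ_of_kp (hKP c hc) subset_rfl
  · -- `‖q c‖ ≤ a n`
    exact norm_polymerLogZ_le_of_site (κ c) ha.le (hempty c) (hsite c hc) Λ hΛne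

end DobrushinHolomorphicLog

end Summit.AtomisticToContinuum.HydrodynamicLimit.Theorems.TiltAnalyticity

end
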